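import Summits.Ventures.PercRepro.ExcessOneDownSetSetup

/-!
# Theorem (YD): the type-I differences of an excess-one family with a tight complex trace form a
down-set

Setting (proofs/MINE1-theoremS.md, Addendum 27): `F` has Marica–Schönheim excess one
(`|F \\ F| = |F| + 1`), `{r} ∈ F`, `∅ ∉ F`, the trace `P := proj r F` is tight and contains every
singleton `{a}`, `a ≠ r`. Write `F₀ = part0 r F`, `F₁ = partr r F`, `Y = diffsY r F` (the type-I
differences `t \ s`, `t ∈ F₁`, `s ∈ F₀`), so that `F \\ F = P ⊔ (Y + r)`.

**Theorem (YD).** `Y` is a down-set (`mem_diffsY_of_subset`); equivalently the whole difference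
family `F \\ F` is a simplicial complex (`isDownSet_diffs`).

The proof of the one-element step `erase_mem_diffsY_of_mem` (`y ∈ Y`, `d ∈ y` ⟹ `y.erase d ∈ Y`):
a failure at `(y, d)` with `y = t \ s` makes `(t.erase d, t)` a `(P₀, K)`-type witness in the
direction `d`, so (W2′) applies: `G := proj d F` is tight, every `d`-pair of the trace is an
`F₀`- or an `F₁`-pair, and `|Λ_d| ≤ |L| + 1` with `L` the lower ends of the `K`–`K` `d`-pairs.

* If `{d} ∈ F`, then `∅ ∈ G`, a tight family containing `∅` is its own difference family, so the
  projected differences are projected members and `y.erase d = t' \ {d}` for some `t' ∈ F₁`.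
* If `{d} ∉ F`, replace `t.erase d` by `z := (t.erase d) \ s` (still a witness, disjoint from `s`,
  with `z ∉ Y` and `insert d z ∈ Y`). The cone step (`exists_sdiff_eq_of_insert_mem_diffsY`,
  Theorem S for the tight `G`) yields two members `g ⊋ z`, `f ≠ ∅` of `G` avoiding `r` with
  `g \ f = z`. Then `g` is not `r`-lifted (else `z ∈ Y`), so `g` and `z` are two partnerless
  members whose `d`-extensions lie in `K` (by (W2′ c) and (W1)); the differences of `L ∪ {z, g}`
  all lie in `Λ_d`, and Marica–Schönheim gives `|Λ_d| ≥ |L| + 2` — a contradiction.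
-/

namespace PercRepro.MSTight

open Finset
open scoped FinsetFamily

variable {α : Type*} [DecidableEq α] [Fintype α]

section DownSet

variable {F : Finset (Finset α)} {r : α}

/-- **Theorem (YD), one step.** For an excess-one family `F` with `{r} ∈ F`, `∅ ∉ F` and a tight
trace containing every singleton, removing an element from a type-I difference gives a type-I
difference: `y ∈ Y`, `d ∈ y` ⟹ `y.erase d ∈ Y`. -/
theorem erase_mem_diffsY_of_mem (hF : (F \\ F).card = F.card + 1) (hP : Tight (proj r F))
    (hr : ({r} : Finset α) ∈ F) (hE : (∅ : Finset α) ∉ F)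
    (hsing : ∀ a, a ≠ r → ({a} : Finset α) ∈ proj r F)
    {y : Finset α} (hy : y ∈ diffsY r F) {d : α} (hd : d ∈ y) : y.erase d ∈ diffsY r F := by
  by_contra hcon
  obtain ⟨t, ht, s, hs, rfl⟩ := Finset.mem_diffs.1 hy
  have hdt : d ∈ t := (mem_sdiff.1 hd).1
  have hds : d ∉ s := (mem_sdiff.1 hd).2
  have hrt : r ∉ t := (mem_partr.1 ht).1
  have hdr : d ≠ r := fun h => hrt (h ▸ hdt)
  have hX : diffsX r F = proj r F := diffsX_eq_proj_of_singleton_mem hP hr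
  have htP : t ∈ proj r F := by rw [proj_eq_union]; exact mem_union_right _ ht
  have hsP : s ∈ proj r F := by rw [proj_eq_union]; exact mem_union_left _ hs
  have hdP : ({d} : Finset α) ∈ proj r F := hsing d hdr
  -- the witness `(x, insert d x)` with `x := t.erase d`
  set x := t.erase d with hxdef
  have hxP : x ∈ proj r F := by
    rw [hxdef, ← sdiff_singleton_eq_erase]; exact sdiff_mem_proj_of_tight hP hr htP hdP
  have hdx : d ∉ x := notMem_erase d t
  have hxd : insert d x = t := insert_erase hdt
  have hxs : x \ s = (t \ s).erase d := by rw [hxdef, erase_sdiff_comm]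
  have hx1 : x ∉ partr r F := fun h => hcon (hxs ▸ sdiff_mem_diffs h hs)
  have hx0 : x ∈ part0 r F := by
    rw [proj_eq_union, mem_union] at hxP
    exact hxP.resolve_right hx1
  have hxd1 : insert d x ∈ partr r F := by rw [hxd]; exact ht
  have hwit : ¬ (x ∈ partr r F ∧ insert d x ∈ part0 r F) := fun h => hx1 h.1
  have hG : Tight (proj d F) := tight_proj_of_witness hF hP hr hx0 hdx hxd1 hwit
  by_cases hd0 : ({d} : Finset α) ∈ F
  · -- Case B: `{d} ∈ F`, so `∅ ∈ G` and `G \\ G = G`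
    have h0G : (∅ : Finset α) ∈ proj d F := mem_proj.2 ⟨{d}, hd0, erase_singleton d⟩
    have hDG : proj d F \\ proj d F = proj d F := diffs_eq_self_of_tight_of_empty_mem hG h0G
    have h1 : insert r (t \ s) ∈ F \\ F := (mem_diffsY_iff.1 hy).2
    have h2 : (insert r (t \ s)).erase d ∈ proj d F := by
      rw [← hDG, diffs_proj_eq_image_erase]; exact mem_image_of_mem _ h1
    obtain ⟨B, hB, hBe⟩ := mem_proj.1 h2
    have hrB : r ∈ B := by
      have : r ∈ B.erase d := by
        rw [hBe, erase_insert_of_ne hdr.symm]; exact mem_insert_self r _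
      exact (mem_erase.1 this).2
    have hd0' : ({d} : Finset α) ∈ part0 r F := mem_part0.2 ⟨hd0, by simpa using hdr.symm⟩
    have hB1 : B.erase r ∈ partr r F :=
      mem_partr.2 ⟨notMem_erase r B, by rw [insert_erase hrB]; exact hB⟩
    have hr' : r ∉ (t \ s).erase d := fun h => hrt (mem_sdiff.1 (mem_erase.1 h).2).1
    have key : (B.erase r) \ {d} = (t \ s).erase d := by
      rw [sdiff_singleton_eq_erase, erase_right_comm, hBe, erase_insert_of_ne hdr.symm,
        erase_insert hr']
    apply hcon
    rw [← key]
    exact sdiff_mem_diffs hB1 hd0'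
  · -- Case A: `{d} ∉ F`
    have hc1 := fun {e} => mem_partr_or_insert_mem_partr_of_witness hF hP hr hE hd0 hx0 hdx hxd1
      hwit (e := e)
    -- the reduced witness `(z, insert d z)` with `z := x \ s`, disjoint from `s`
    have hzY : x \ s ∉ diffsY r F := by rw [hxs]; exact hcon
    obtain ⟨_, hz0, hz1, hzd0⟩ := sdiff_mem_part0_of_not_mem_diffsY hF hP hr hx0 hx1 hdx hxd1 hs hzY
    set z := x \ s with hzdef
    have hzP : z ∈ proj r F := sdiff_mem_proj_of_tight hP hr hxP hsP
    have hdz : d ∉ z := fun h => hdx (mem_sdiff.1 h).1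
    have hrz : r ∉ z := (mem_part0.1 hz0).2
    have hzd : insert d z = t \ s := by rw [hzdef, ← insert_sdiff_of_notMem x hds, hxd]
    have hzd1 : insert d z ∈ partr r F := (hc1 hzP hdz).resolve_left hz1
    have hzwit : ¬ (z ∈ partr r F ∧ insert d z ∈ part0 r F) := fun h => hz1 h.1
    have hzdY : insert d z ∈ diffsY r F := by rw [hzd]; exact hy
    -- the cone step: `g ⊋ z`, `f` nonempty, `g \ f = z`, both members of `proj d F` avoiding `r`
    obtain ⟨g, hgG, f, hfG, hrg, hrf, hfne, hfg, hfz, hgf⟩ :=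
      exists_sdiff_eq_of_insert_mem_diffsY hF hP hr hE hd0 hz0 hdz hzd1 hzwit hdz hrz hzdY
    have hdg : d ∉ g := notMem_of_mem_proj' hgG
    -- `f` comes from a member `Bf ∈ F₀` with `g \ Bf = z`
    obtain ⟨Bf, hBf, hBfe⟩ := mem_proj.1 hfG
    have hrBf : r ∉ Bf := fun h => hrf (by rw [← hBfe]; exact mem_erase.2 ⟨hdr.symm, h⟩)
    have hBf0 : Bf ∈ part0 r F := mem_part0.2 ⟨hBf, hrBf⟩
    have hgBf : g \ Bf = z := by
      rw [← hgf]
      ext a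
      simp only [mem_sdiff]
      constructor
      · rintro ⟨hag, haB⟩
        refine ⟨hag, fun haf => haB ?_⟩
        rw [← hBfe] at haf
        exact (mem_erase.1 haf).2
      · rintro ⟨hag, haf⟩
        refine ⟨hag, fun haB => haf ?_⟩
        rw [← hBfe]
        exact mem_erase.2 ⟨fun h => hdg (h ▸ hag), haB⟩
    -- `g` is a face of the trace
    obtain ⟨Bg, hBg, hBge⟩ := mem_proj.1 hgG
    have hrBg : r ∉ Bg := fun h => hrg (by rw [← hBge]; exact mem_erase.2 ⟨hdr.symm, h⟩)
    have hBgP : Bg ∈ proj r F := by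
      rw [proj_eq_union]; exact mem_union_left _ (mem_part0.2 ⟨hBg, hrBg⟩)
    have hgP : g ∈ proj r F := by
      rw [← hBge, ← sdiff_singleton_eq_erase]; exact sdiff_mem_proj_of_tight hP hr hBgP hdP
    -- `g` is partnerless and `insert d g ∈ K`
    have hg1 : g ∉ partr r F := fun h => hzY (hgBf ▸ sdiff_mem_diffs h hBf0)
    have hg0 : g ∈ part0 r F := by
      rw [proj_eq_union, mem_union] at hgP; exact hgP.resolve_right hg1
    have hgd1 : insert d g ∈ partr r F := (hc1 hgP hdg).resolve_left hg1
    have hgd0 : insert d g ∈ part0 r F := by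
      by_contra hno
      exact not_insert_mem_partr_sdiff_part0 hF hP hr hg0 hg1 hdg hgd1 hno
    -- the count at `d`: `|Λ_d| ≤ |L| + 1` (the trace identity) …
    set lk := (proj r F).filter fun e => d ∉ e ∧ insert d e ∈ proj r F with hlk
    set lam := (diffsY r F).filter fun y => d ∉ y ∧ insert d y ∈ diffsY r F with hlam
    set L0 := (part0 r F).filter fun s => d ∉ s ∧ insert d s ∈ part0 r F with hL0
    set L1 := (partr r F).filter fun t => d ∉ t ∧ insert d t ∈ partr r F with hL1
    set L := L0 ∩ L1 with hL
    have hA : lk.card + lam.card ≤ (diffsX d F ∩ diffsY d F).card := card_lk_add_card_lam_le hdr hX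
    have hB : (diffsX d F ∩ diffsY d F).card ≤ (partner d F).card + 1 :=
      card_diffsX_inter_diffsY_le_of_card_diffs_eq d hF
    have hC : (partner d F).card ≤ L0.card + L1.card := card_partner_le_card_L0_add_card_L1 hdr
    have hD : (L0 ∪ L1).card ≤ lk.card := by
      apply card_le_card
      apply union_subset
      · intro s' hs'
        rw [hL0, mem_filter] at hs'
        rw [hlk, mem_filter, proj_eq_union]
        exact ⟨mem_union_left _ hs'.1, hs'.2.1, mem_union_left _ hs'.2.2⟩
      · intro t' ht'
        rw [hL1, mem_filter] at ht'
        rw [hlk, mem_filter, proj_eq_union]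
        exact ⟨mem_union_right _ ht'.1, ht'.2.1, mem_union_right _ ht'.2.2⟩
    have hE' : (L0 ∪ L1).card + L.card = L0.card + L1.card := card_union_add_card_inter L0 L1
    have hup : lam.card ≤ L.card + 1 := by omega
    -- … against `|Λ_d| ≥ |L ∪ {z, g}| = |L| + 2` (Marica–Schönheim)
    have hzL : z ∉ L := fun h => hz1 (mem_filter.1 (mem_inter.1 h).2).1
    have hgL : g ∉ L := fun h => hg1 (mem_filter.1 (mem_inter.1 h).2).1
    have hzg : z ≠ g := by
      intro h
      obtain ⟨a, ha⟩ := hfne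
      exact disjoint_left.1 hfz ha (by rw [h]; exact hfg ha)
    have hcardM : (insert z (insert g L)).card = L.card + 2 := by
      rw [card_insert_of_notMem, card_insert_of_notMem hgL]
      rw [mem_insert, not_or]; exact ⟨hzg, hzL⟩
    have hup1 : ∀ a ∈ insert z (insert g L), d ∉ a ∧ insert d a ∈ partr r F := by
      intro a ha
      rw [mem_insert, mem_insert] at ha
      rcases ha with h | h | h
      · rw [h]; exact ⟨hdz, hzd1⟩
      · rw [h]; exact ⟨hdg, hgd1⟩
      · have := mem_filter.1 (mem_inter.1 h).2; exact ⟨this.2.1, this.2.2⟩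
    have hlow : ∀ a ∈ insert z (insert g L), a ∈ part0 r F ∧ d ∉ a ∧ insert d a ∈ part0 r F := by
      intro a ha
      rw [mem_insert, mem_insert] at ha
      rcases ha with h | h | h
      · rw [h]; exact ⟨hz0, hdz, hzd0⟩
      · rw [h]; exact ⟨hg0, hdg, hgd0⟩
      · have := mem_filter.1 (mem_inter.1 h).1; exact ⟨this.1, this.2.1, this.2.2⟩
    have hsub : insert z (insert g L) \\ insert z (insert g L) ⊆ lam := by
      intro e he
      obtain ⟨a, ha, a', ha', rfl⟩ := Finset.mem_diffs.1 he
      obtain ⟨hda, had1⟩ := hup1 a ha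
      obtain ⟨ha0', hda', hda0'⟩ := hlow a' ha'
      rw [hlam, mem_filter]
      refine ⟨?_, fun h => hda (mem_sdiff.1 h).1, ?_⟩
      · rw [← insert_sdiff_insert_of_notMem hda]; exact sdiff_mem_diffs had1 hda0'
      · rw [← insert_sdiff_of_notMem a hda']; exact sdiff_mem_diffs had1 ha0'
    have hlow2 : (insert z (insert g L)).card ≤ lam.card :=
      (Finset.card_le_card_diffs _).trans (card_le_card hsub)
    omega

/-- **Theorem (YD).** The type-I differences of an excess-one family with `{r} ∈ F`, `∅ ∉ F` and
a tight trace containing every singleton form a down-set. -/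
theorem mem_diffsY_of_subset (hF : (F \\ F).card = F.card + 1) (hP : Tight (proj r F))
    (hr : ({r} : Finset α) ∈ F) (hE : (∅ : Finset α) ∉ F)
    (hsing : ∀ a, a ≠ r → ({a} : Finset α) ∈ proj r F)
    {y : Finset α} (hy : y ∈ diffsY r F) {y' : Finset α} (hy' : y' ⊆ y) : y' ∈ diffsY r F := by
  induction y using Finset.strongInduction with
  | H y ih =>
    by_cases h : y' = y
    · rw [h]; exact hy
    · obtain ⟨a, hay, hay'⟩ := exists_of_ssubset (Finset.ssubset_iff_subset_ne.2 ⟨hy', h⟩)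
      exact ih (y.erase a) (erase_ssubset hay) (erase_mem_diffsY_of_mem hF hP hr hE hsing hy hay)
        (subset_erase.2 ⟨hy', hay'⟩)

/-- **Theorem (YD), global form.** The difference family of an excess-one family with `{r} ∈ F`,
`∅ ∉ F` and a tight trace containing every singleton is a simplicial complex. -/
theorem isDownSet_diffs (hF : (F \\ F).card = F.card + 1) (hP : Tight (proj r F))
    (hr : ({r} : Finset α) ∈ F) (hE : (∅ : Finset α) ∉ F)
    (hsing : ∀ a, a ≠ r → ({a} : Finset α) ∈ proj r F) : IsDownSet (F \\ F) := by
  intro E hE' E' hE'E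
  have hX : diffsX r F = proj r F := diffsX_eq_proj_of_singleton_mem hP hr
  by_cases hrE' : r ∈ E'
  · have hrE : r ∈ E := hE'E hrE'
    have h1 : E.erase r ∈ diffsY r F := mem_diffsY_iff.2 ⟨notMem_erase r E, by rwa [insert_erase hrE]⟩
    have h2 : E'.erase r ∈ diffsY r F :=
      mem_diffsY_of_subset hF hP hr hE hsing h1 (erase_subset_erase r hE'E)
    have h3 := (mem_diffsY_iff.1 h2).2
    rwa [insert_erase hrE'] at h3
  · have hEP : E.erase r ∈ proj r F := by
      by_cases hrE : r ∈ E
      · exact mem_proj_of_mem_diffsY hP hr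
          (mem_diffsY_iff.2 ⟨notMem_erase r E, by rwa [insert_erase hrE]⟩)
      · rw [erase_eq_of_notMem hrE, ← hX, mem_diffsX_iff]; exact ⟨hE', hrE⟩
    have hE'P : E' ∈ proj r F :=
      mem_proj_of_subset hP hr hsing hEP (subset_erase.2 ⟨hE'E, hrE'⟩)
    rw [← hX, mem_diffsX_iff] at hE'P
    exact hE'P.1

end DownSet

end PercRepro.MSTight
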